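/-
Copyright (c) 2026 the pub-hodgecm-mathlib formalisation cell (harness21).  Prover seat hodgecm-mathlib-R90-C133-p02 (g2), Track B ∕ R90-TF, h413 = `stmt-HodgeConjecture-24833`,
R90-TF section S8 «ContSpec-n½» (S8 dealer R90-CS-plan (g3) S8-R175 (1) ∕ S8-R186; census `R90/S8/CENSUS-ADM-payer.R90-C133-p02-g2.md` 1918f47b2978fa74 item 6 + the (W1′)
refinement 2026-09-05T01:3xZ): THE ASSEMBLY of the (ADM) payer road — the `K_max`-admissibility letter `hADM` of ★ p863816 `hDISC_of_inv_of_admissible`, in its bytes, from the ★ steps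
(α) p863908, (β′) p863949, (γ) p863857 and TWO visible letters: ★ p863302's Godement summability `hsum` (★ for bounded sections) and the DENSITY letter (W1′).
-/
import Summits.HodgeConjecture.HodgeConjecture.Theorems.R90S8ResGMidResidueGraphBotU3        -- ★ p863949 (β′): `exists_midResidueGraph_bot`, vertical line, `K_max`-transport, `toLinearPMap_rightTranslation`; brings ★ p863816 (`restrict_apply_mem_resGMidAtom_bot`), ★ p863302, ★ p863205, ★ D1
import Summits.HodgeConjecture.HodgeConjecture.Theorems.R90S8ChiSectionPairKTypeFiniteU3      -- ★ p863857 (γ): `commute_of_mem_bot`, `finiteDimensional_chiSectionSpacePairKType_kMax_bot`; brings ★ (3′) p863637 `chiSectionSpacePairKType`, L3 `range_le_chiSectionSpacePairKType`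
import Summits.HodgeConjecture.HodgeConjecture.Theorems.R90S8TauPartFiniteOfGeneratorsU3       -- ★ p863908 (α): `finiteDimensional_homRangeSum_subRep_of_generators`, Schur `nonempty_equiv_subRep_range_of_injective ∕ isIrreducible_subRep_range_of_injective ∕ apply_mem_range_of_mem_range`, `starProjection_closure_homRangeSum_mem_of_dichotomy`
import HarnessLib

/-!
# S8 (R)′ road — `R90S8ResGMidAtomBotAdmissibleOfLettersU3`: THE LEVEL-FREE MIDDLE-POLE RESIDUE ATOM IS `K_max`-ADMISSIBLE, MODULO {`hsum`, (W1′)} — the `hADM` letter of ★ p863816 ASSEMBLED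

Track B ∕ R90-TF, crux h413 = `stmt-HodgeConjecture-24833`, route of record `HCCMUnconditional`; cell `hodgecm-mathlib`, R90-TF section S8 «ContSpec-n½ ∕ ResidualSpectrum», socket (R)
`sock_S8_res_midBlock_le_residual` (B ED. 7 :337) ← ★ `res_midBlock_le_residual_of_letters' (hDISC) (hROAD) (hCT)` (p863422) ← ★ p863816 `hDISC_of_inv_of_admissible (hINV) (hADM)` ←
**THIS FILE: `hADM_of_letters (hSUM) (hW1)` in `hADM`'s bytes.**  THEOREMS ONLY (no `def`, no `instance`, no `notation`, no named-fact hypothesis, no `sorry`; default heartbeats); lane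
`--supports stmt-HodgeConjecture-24833 --as helper` (count-neutral).  CLOSES NO SOCKET.  After it, (R)′'s row `hDISC` reads ★ ∘ {(INV) L letter, (W1′) density letter, `hsum`}.

THE MATHEMATICS ([WallachRRG1] §1.4.6–1.4.7, §3.3.1; [MoeglinWaldspurger1995] I.2.17, II.1.5, IV.1.11, V.3.13; [HarishChandraTAMS1953] Thm. 5; [Rogawski1990] §13.9 p. 229 (ii)).
`σ := R|_{K_max}` (unitary) on `L²`, `A := resGMidAtom ξ μω ⊥ 1` (closed, `K_max`-stable ★), `τ := σ|_E` an irreducible `K_max`-type.  (W1′): `A` lies in the closed span of the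
generators `f = [Res φ]` whose section `φ` lies in a finite-dimensional `K_max`-STABLE IRREDUCIBLE space `S` of sections (in print: the `K`-finite residues are total and every `K`-finite
section is a finite sum of such — unitarian trick; as typed: exactly as true as `hDISC`).  For such `f`: the residue relation `Gr` (★ (β′), modulo `hsum`) contains `(φ, f)`; its domain is
`K_max`-stable and meets the irreducible `S` in `φ ≠ 0`, so `S ⊆ dom` and `Res|_S : S → L²` is a `K_max`-map (★ `toLinearPMap_rightTranslation`) with `Res φ = f`; SCHUR: `Res|_S` is
injective or zero; if zero, `f = 0`; else `N := Res(S) ≅ S` is an irreducible finite-dimensional stable subspace containing `f`, and (★ (α) dichotomy) `Q_τ f = 0` unless `τ ≃ σ|_N ≃ S`,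
in which case `S ⊆ V(⊥,1)^τ` (★ (3′) L3 on the `K_max`-map `τ ≃ S ↪ sections`) and `Q_τ f ∈ N ⊆ M_τ :=` the residue classes of the sections in `V(⊥,1)^τ` — finite-dimensional because
the first projection is injective on `Gr` (★ (β′)) and `V(⊥,1)^τ` is finite-dimensional (★ (γ), Frobenius via Iwasawa).  ★ (α) §1 then bounds the `τ`-part of `σ|_A` by `M_τ`.
* §1 (generic) `submodule_le_of_isIrreducible` (an irreducible stable `S` meeting a stable `D` in a non-zero vector lies in `D`).
* §2 **`finiteDimensional_homRangeSum_resGMidAtom_bot_of_letters (hsum) (hW1)`** (one `(L, μ, ξ, μω)`; conclusion = ★ p863816's `hadm` binder body), and the ∀-closed export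
  **`hADM_of_letters (hSUM) (hW1) : ‹hADM bytes of ★ p863816 :356–:369›`** — consumer: `hDISC_of_inv_of_admissible hINV (hADM_of_letters hSUM hW1)`.
HONEST LABEL: HC_CM is proved only modulo the 7 printed citations (2 remaining named inputs: hLiu418 = `stmt-HodgeConjecture-24832`, h413 = `stmt-HodgeConjecture-24833`) until
rung 0 closes; REL ≠ ★ ≠ BUILT; `hADM` is now «★ modulo {`hsum`, (W1′)}», `hDISC` «★ modulo {(INV), (W1′), `hsum`}» — all three OPEN letters, (INV)∕(W1′) L and NOT promised; pays no socket;
count-neutral.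

## References
* [WallachRRG1] N. R. Wallach, *Real Reductive Groups I* (1988), §1.4.6–1.4.7, §3.3.1.
* [MoeglinWaldspurger1995] C. Mœglin, J.-L. Waldspurger, *Spectral Decomposition and Eisenstein Series* (1995), I.2.17, II.1.5, IV.1.11, V.3.13.
* [HarishChandraTAMS1953] Harish-Chandra, *Representations of a semisimple Lie group on a Banach space. I*, Trans. AMS 75 (1953), Thm. 5.
* [Rogawski1990] J. D. Rogawski, *Automorphic Representations of Unitary Groups in Three Variables* (1990), §13.9 p. 229 (ii).
-/

set_option autoImplicit false
set_option linter.dupNamespace false  -- the mandated namespace `…HodgeConjecture.HodgeConjecture.R90.S8` (LEAD #1 L1) repeats the summit's segment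

noncomputable section

open MeasureTheory Measure Set Filter Topology NumberField ContRepresentation
open Literature.NumberTheory Literature.NumberTheory.Automorphic Literature.NumberTheory.Automorphic.UnitaryGroup Literature.NumberTheory.GaloisRepresentations AdelicGroupData
open Literature.NumberTheory.Automorphic.Arthur2013.Leaves.TECR Literature.NumberTheory.Rogawski1990
open Summit.HodgeConjecture.HodgeConjecture.Cruxes.H413.K2E1BorelEisensteinU
open Summit.HodgeConjecture.HodgeConjecture.Cruxes.H413.K2E1CharacterEisensteinU3PairDefs
open Summit.HodgeConjecture.HodgeConjecture.Cruxes.H413.K2E1ChiSectionSpaceU3PairDefs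
open scoped ENNReal NNReal

namespace Summit.HodgeConjecture.HodgeConjecture.R90.S8

/-! ## §1 Generic: an irreducible stable subspace meeting a stable subspace non-trivially lies in it -/

/-- **An irreducible stable `S` meeting a stable `D` in a non-zero vector lies in `D`**: `S ⊓ D`, pulled back to `S`, is a subrepresentation of the irreducible `ρ|_S`, non-zero, hence
everything (`IsSimpleOrder`). [cite: WallachRRG1, §1.4.6] -/
theorem submodule_le_of_isIrreducible {K M : Type*} [Group K] [AddCommGroup M] [Module ℂ M] (ρ : Representation ℂ K M)
    {S : Submodule ℂ M} (hS : ∀ k, ∀ v ∈ S, ρ k v ∈ S) (hirr : (Subrepresentation.toRepresentation (⟨S, hS⟩ : Subrepresentation ρ)).IsIrreducible)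
    {D : Submodule ℂ M} (hD : ∀ k, ∀ v ∈ D, ρ k v ∈ D) {φ : M} (hφS : φ ∈ S) (hφD : φ ∈ D) (hφ0 : φ ≠ 0) : S ≤ D := by
  let U : Subrepresentation (Subrepresentation.toRepresentation (⟨S, hS⟩ : Subrepresentation ρ)) :=
    ⟨(S ⊓ D).comap S.subtype, fun k v hv => ⟨hS k _ v.2, hD k _ hv.2⟩⟩
  haveI := hirr
  rcases IsSimpleOrder.eq_bot_or_eq_top U with h | h
  · exfalso
    apply hφ0
    have hmem : (⟨φ, hφS⟩ : ↥S) ∈ U.toSubmodule := ⟨hφS, hφD⟩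
    rw [h] at hmem
    exact congrArg Subtype.val ((Submodule.mem_bot ℂ).1 hmem)
  · intro ψ hψ
    have hmem : (⟨ψ, hψ⟩ : ↥S) ∈ U.toSubmodule := by
      rw [h]
      exact Submodule.mem_top
    exact hmem.2

/-! ## §2 The assembly: `hADM ⇐ hsum + (W1′)` -/

section Main

variable (L : Type) [Field L] [NumberField L] [IsCMField L]
  (μ : Measure (quasiSplit (↥(maximalRealSubfield L)) L (IsCMField.complexConj L) 3).automorphicQuotient)
  [(quasiSplit (↥(maximalRealSubfield L)) L (IsCMField.complexConj L) 3).IsAutomorphicMeasure μ]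
  (ξ : OneDimAutRepH L) (μω : HeckeCharacter L)

set_option maxHeartbeats 400000 in
/-- **THE LEVEL-FREE ATOM IS `K_max`-ADMISSIBLE, MODULO `hsum` AND (W1′)** — one `(L, μ, ξ, μω)`; conclusion = the body of ★ p863816's `hadm` binder (the `τ_E`-part of `σ|_A` is
finite-dimensional for every finite-dimensional `K_max`-stable irreducible `E ≤ A := resGMidAtom ξ μω ⊥ 1`, `σ := R|_{K_max}`).  Letters: `hsum` (★ p863302's Godement summability at
level `(⊥, 1)`, ★ for bounded sections) and `hW1` = (W1′) «`A ≤ cl span {f | ∃ φ, REL(φ, f) ∧ φ` lies in a finite-dimensional `K_max`-stable IRREDUCIBLE space of sections`}`».  Proof = the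
module docstring: ★ (β′) graph + Schur + ★ (α) dichotomy + ★ (3′) L3 + ★ (γ), fed to ★ (α) §1 with `F := M_τ`. [cite: WallachRRG1, §3.3.1] [cite: MoeglinWaldspurger1995, I.2.17, V.3.13]
[cite: HarishChandraTAMS1953, Thm. 5] [cite: Rogawski1990, §13.9 p. 229 (ii)] -/
theorem finiteDimensional_homRangeSum_resGMidAtom_bot_of_letters
    (hsum : ∀ φ ∈ chiSectionSpacePair (ξ.bcη⁻¹ * ξ.bcψ⁻¹ * μω) ξ.ψ (⊥ : Subgroup (quasiSplit (↥(maximalRealSubfield L)) L (IsCMField.complexConj L) 3).Adelic)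
          ((1 : ↥(⊥ : Subgroup (quasiSplit (↥(maximalRealSubfield L)) L (IsCMField.complexConj L) 3).Adelic) →* ℂ) : ↥(⊥ : Subgroup (quasiSplit (↥(maximalRealSubfield L)) L (IsCMField.complexConj L) 3).Adelic) → ℂ),
      Continuous φ → ∀ z : ℂ, 2 < z.re → ∀ g : (quasiSplit (↥(maximalRealSubfield L)) L (IsCMField.complexConj L) 3).Adelic,
      Summable fun q : Quotient (MulAction.orbitRel ↥(borelU ((IsCMField.complexConj L : L ≃ₐ[↥(maximalRealSubfield L)] L) : L →+* L) ((StdForm.antidiagonal 3).over L)) ↥(unitaryGroupOfForm ((IsCMField.complexConj L : L ≃ₐ[↥(maximalRealSubfield L)] L) : L →+* L) ((StdForm.antidiagonal 3).over L))) =>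
        ‖flatSectionU φ z ((quasiSplit (↥(maximalRealSubfield L)) L (IsCMField.complexConj L) 3).toAdelic (Quotient.out q : ↥(unitaryGroupOfForm ((IsCMField.complexConj L : L ≃ₐ[↥(maximalRealSubfield L)] L) : L →+* L) ((StdForm.antidiagonal 3).over L))) * g)‖)
    (hW1 : resGMidAtom L μ ξ μω ⊥ 1 ≤ (Submodule.span ℂ {f : (quasiSplit (↥(maximalRealSubfield L)) L (IsCMField.complexConj L) 3).L2 μ | ∃ φ : (quasiSplit (↥(maximalRealSubfield L)) L (IsCMField.complexConj L) 3).Adelic → ℂ, (φ ∈ chiSectionSpacePair (ξ.bcη⁻¹ * ξ.bcψ⁻¹ * μω) ξ.ψ (⊥ : Subgroup (quasiSplit (↥(maximalRealSubfield L)) L (IsCMField.complexConj L) 3).Adelic)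
          ((1 : ↥(⊥ : Subgroup (quasiSplit (↥(maximalRealSubfield L)) L (IsCMField.complexConj L) 3).Adelic) →* ℂ) : ↥(⊥ : Subgroup (quasiSplit (↥(maximalRealSubfield L)) L (IsCMField.complexConj L) 3).Adelic) → ℂ) ∧ Continuous φ ∧
          ∃ (Ec : ℂ → (quasiSplit (↥(maximalRealSubfield L)) L (IsCMField.complexConj L) 3).Adelic → ℂ) (Sp : Finset ℂ)
            (_ : ∀ s ∈ Sp, s.im = 0 ∧ 1 < s.re ∧ s.re ≤ 2)
            (_ : ∀ g, DifferentiableOn ℂ (fun z => Ec z g) ({z : ℂ | 1 < z.re} \ (↑Sp : Set ℂ)))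
            (_ : ∀ z : ℂ, 2 < z.re → Ec z = eisensteinSeriesU (flatSectionU φ z))
            (Fp : (quasiSplit (↥(maximalRealSubfield L)) L (IsCMField.complexConj L) 3).Adelic → ℂ → ℂ)
            (_ : ∀ g, AnalyticAt ℂ (Fp g) ((3 : ℂ) / 2))
            (_ : ∀ g, Fp g =ᶠ[𝓝[≠] ((3 : ℂ) / 2)] fun z => (z - (3 : ℂ) / 2) * Ec z g),
            (f : (quasiSplit (↥(maximalRealSubfield L)) L (IsCMField.complexConj L) 3).automorphicQuotient → ℂ) =ᵐ[μ] (fun x : (quasiSplit (↥(maximalRealSubfield L)) L (IsCMField.complexConj L) 3).automorphicQuotient => Fp (Quotient.out (x : ((quasiSplit (↥(maximalRealSubfield L)) L (IsCMField.complexConj L) 3).Adelic ⧸ (quasiSplit (↥(maximalRealSubfield L)) L (IsCMField.complexConj L) 3).quotientSubgroup)))⁻¹ ((3 : ℂ) / 2))) ∧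
          ∃ (S : Submodule ℂ ((quasiSplit (↥(maximalRealSubfield L)) L (IsCMField.complexConj L) 3).Adelic → ℂ)) (hS : ∀ k : ↥((standardMaximalCompactGL 3 L).comap (adelicVal (↥(maximalRealSubfield L)) L (IsCMField.complexConj L) 3 ((StdForm.antidiagonal 3).over L)) :
      Subgroup (quasiSplit (↥(maximalRealSubfield L)) L (IsCMField.complexConj L) 3).Adelic), ∀ ψ ∈ S, ((rightTranslation (quasiSplit (↥(maximalRealSubfield L)) L (IsCMField.complexConj L) 3)).comp ((standardMaximalCompactGL 3 L).comap (adelicVal (↥(maximalRealSubfield L)) L (IsCMField.complexConj L) 3 ((StdForm.antidiagonal 3).over L)) :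
      Subgroup (quasiSplit (↥(maximalRealSubfield L)) L (IsCMField.complexConj L) 3).Adelic).subtype) k ψ ∈ S),
            φ ∈ S ∧ FiniteDimensional ℂ ↥S ∧ (Subrepresentation.toRepresentation (⟨S, hS⟩ : Subrepresentation ((rightTranslation (quasiSplit (↥(maximalRealSubfield L)) L (IsCMField.complexConj L) 3)).comp ((standardMaximalCompactGL 3 L).comap (adelicVal (↥(maximalRealSubfield L)) L (IsCMField.complexConj L) 3 ((StdForm.antidiagonal 3).over L)) :
      Subgroup (quasiSplit (↥(maximalRealSubfield L)) L (IsCMField.complexConj L) 3).Adelic).subtype))).IsIrreducible}).topologicalClosure)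
    (hA : ∀ (k : ↥((standardMaximalCompactGL 3 L).comap (adelicVal (↥(maximalRealSubfield L)) L (IsCMField.complexConj L) 3 ((StdForm.antidiagonal 3).over L)) :
      Subgroup (quasiSplit (↥(maximalRealSubfield L)) L (IsCMField.complexConj L) 3).Adelic)), ∀ x ∈ resGMidAtom L μ ξ μω ⊥ 1,
        (((quasiSplit (↥(maximalRealSubfield L)) L (IsCMField.complexConj L) 3).rightRegular μ).restrict ((standardMaximalCompactGL 3 L).comap (adelicVal (↥(maximalRealSubfield L)) L (IsCMField.complexConj L) 3 ((StdForm.antidiagonal 3).over L)) :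
      Subgroup (quasiSplit (↥(maximalRealSubfield L)) L (IsCMField.complexConj L) 3).Adelic).subtype) k x ∈ resGMidAtom L μ ξ μω ⊥ 1)
    (E : Submodule ℂ ((quasiSplit (↥(maximalRealSubfield L)) L (IsCMField.complexConj L) 3).L2 μ)) (hE : ∀ k, ∀ x ∈ E, (((quasiSplit (↥(maximalRealSubfield L)) L (IsCMField.complexConj L) 3).rightRegular μ).restrict ((standardMaximalCompactGL 3 L).comap (adelicVal (↥(maximalRealSubfield L)) L (IsCMField.complexConj L) 3 ((StdForm.antidiagonal 3).over L)) :
      Subgroup (quasiSplit (↥(maximalRealSubfield L)) L (IsCMField.complexConj L) 3).Adelic).subtype) k x ∈ E) (hfd : FiniteDimensional ℂ ↥E)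
    (hirr : ((((quasiSplit (↥(maximalRealSubfield L)) L (IsCMField.complexConj L) 3).rightRegular μ).restrict ((standardMaximalCompactGL 3 L).comap (adelicVal (↥(maximalRealSubfield L)) L (IsCMField.complexConj L) 3 ((StdForm.antidiagonal 3).over L)) :
      Subgroup (quasiSplit (↥(maximalRealSubfield L)) L (IsCMField.complexConj L) 3).Adelic).subtype).subRep E hE).IsIrreducible) :
    FiniteDimensional ℂ ↥(Representation.homRangeSum ((((quasiSplit (↥(maximalRealSubfield L)) L (IsCMField.complexConj L) 3).rightRegular μ).restrict ((standardMaximalCompactGL 3 L).comap (adelicVal (↥(maximalRealSubfield L)) L (IsCMField.complexConj L) 3 ((StdForm.antidiagonal 3).over L)) :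
      Subgroup (quasiSplit (↥(maximalRealSubfield L)) L (IsCMField.complexConj L) 3).Adelic).subtype).subRep (resGMidAtom L μ ξ μω ⊥ 1) hA) ((((quasiSplit (↥(maximalRealSubfield L)) L (IsCMField.complexConj L) 3).rightRegular μ).restrict ((standardMaximalCompactGL 3 L).comap (adelicVal (↥(maximalRealSubfield L)) L (IsCMField.complexConj L) 3 ((StdForm.antidiagonal 3).over L)) :
      Subgroup (quasiSplit (↥(maximalRealSubfield L)) L (IsCMField.complexConj L) 3).Adelic).subtype).subRep E hE)) := by
  haveI : FiniteDimensional ℂ ↥E := hfd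
  have hσu : (((quasiSplit (↥(maximalRealSubfield L)) L (IsCMField.complexConj L) 3).rightRegular μ).restrict ((standardMaximalCompactGL 3 L).comap (adelicVal (↥(maximalRealSubfield L)) L (IsCMField.complexConj L) 3 ((StdForm.antidiagonal 3).over L)) :
      Subgroup (quasiSplit (↥(maximalRealSubfield L)) L (IsCMField.complexConj L) 3).Adelic).subtype).IsUnitary := fun k => (quasiSplit (↥(maximalRealSubfield L)) L (IsCMField.complexConj L) 3).isUnitary_rightRegular μ _
  obtain ⟨Gr, hGr⟩ := exists_midResidueGraph_bot L μ ξ μω hsum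
  -- the finite-dimensional target `M_τ := snd '' (Gr ⊓ fst⁻¹ V(⊥,1)^τ)`
  haveI hVfd : FiniteDimensional ℂ ↥(chiSectionSpacePairKType (ξ.bcη⁻¹ * ξ.bcψ⁻¹ * μω) ξ.ψ (⊥ : Subgroup (quasiSplit (↥(maximalRealSubfield L)) L (IsCMField.complexConj L) 3).Adelic) ((1 : ↥(⊥ : Subgroup (quasiSplit (↥(maximalRealSubfield L)) L (IsCMField.complexConj L) 3).Adelic) →* ℂ) : ↥(⊥ : Subgroup (quasiSplit (↥(maximalRealSubfield L)) L (IsCMField.complexConj L) 3).Adelic) → ℂ) ((standardMaximalCompactGL 3 L).comap (adelicVal (↥(maximalRealSubfield L)) L (IsCMField.complexConj L) 3 ((StdForm.antidiagonal 3).over L)) :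
      Subgroup (quasiSplit (↥(maximalRealSubfield L)) L (IsCMField.complexConj L) 3).Adelic).subtype (commute_of_mem_bot ((standardMaximalCompactGL 3 L).comap (adelicVal (↥(maximalRealSubfield L)) L (IsCMField.complexConj L) 3 ((StdForm.antidiagonal 3).over L)) :
      Subgroup (quasiSplit (↥(maximalRealSubfield L)) L (IsCMField.complexConj L) 3).Adelic).subtype) ((((quasiSplit (↥(maximalRealSubfield L)) L (IsCMField.complexConj L) 3).rightRegular μ).restrict ((standardMaximalCompactGL 3 L).comap (adelicVal (↥(maximalRealSubfield L)) L (IsCMField.complexConj L) 3 ((StdForm.antidiagonal 3).over L)) :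
      Subgroup (quasiSplit (↥(maximalRealSubfield L)) L (IsCMField.complexConj L) 3).Adelic).subtype).subRep E hE)) := finiteDimensional_chiSectionSpacePairKType_kMax_bot L
  have hPfd : FiniteDimensional ℂ ↥(Gr ⊓ (chiSectionSpacePairKType (ξ.bcη⁻¹ * ξ.bcψ⁻¹ * μω) ξ.ψ (⊥ : Subgroup (quasiSplit (↥(maximalRealSubfield L)) L (IsCMField.complexConj L) 3).Adelic) ((1 : ↥(⊥ : Subgroup (quasiSplit (↥(maximalRealSubfield L)) L (IsCMField.complexConj L) 3).Adelic) →* ℂ) : ↥(⊥ : Subgroup (quasiSplit (↥(maximalRealSubfield L)) L (IsCMField.complexConj L) 3).Adelic) → ℂ) ((standardMaximalCompactGL 3 L).comap (adelicVal (↥(maximalRealSubfield L)) L (IsCMField.complexConj L) 3 ((StdForm.antidiagonal 3).over L)) :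
      Subgroup (quasiSplit (↥(maximalRealSubfield L)) L (IsCMField.complexConj L) 3).Adelic).subtype (commute_of_mem_bot ((standardMaximalCompactGL 3 L).comap (adelicVal (↥(maximalRealSubfield L)) L (IsCMField.complexConj L) 3 ((StdForm.antidiagonal 3).over L)) :
      Subgroup (quasiSplit (↥(maximalRealSubfield L)) L (IsCMField.complexConj L) 3).Adelic).subtype) ((((quasiSplit (↥(maximalRealSubfield L)) L (IsCMField.complexConj L) 3).rightRegular μ).restrict ((standardMaximalCompactGL 3 L).comap (adelicVal (↥(maximalRealSubfield L)) L (IsCMField.complexConj L) 3 ((StdForm.antidiagonal 3).over L)) :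
      Subgroup (quasiSplit (↥(maximalRealSubfield L)) L (IsCMField.complexConj L) 3).Adelic).subtype).subRep E hE)).comap (LinearMap.fst ℂ ((quasiSplit (↥(maximalRealSubfield L)) L (IsCMField.complexConj L) 3).Adelic → ℂ) ((quasiSplit (↥(maximalRealSubfield L)) L (IsCMField.complexConj L) 3).L2 μ))) := by
    refine FiniteDimensional.of_injective (LinearMap.codRestrict (chiSectionSpacePairKType (ξ.bcη⁻¹ * ξ.bcψ⁻¹ * μω) ξ.ψ (⊥ : Subgroup (quasiSplit (↥(maximalRealSubfield L)) L (IsCMField.complexConj L) 3).Adelic) ((1 : ↥(⊥ : Subgroup (quasiSplit (↥(maximalRealSubfield L)) L (IsCMField.complexConj L) 3).Adelic) →* ℂ) : ↥(⊥ : Subgroup (quasiSplit (↥(maximalRealSubfield L)) L (IsCMField.complexConj L) 3).Adelic) → ℂ) ((standardMaximalCompactGL 3 L).comap (adelicVal (↥(maximalRealSubfield L)) L (IsCMField.complexConj L) 3 ((StdForm.antidiagonal 3).over L)) :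
      Subgroup (quasiSplit (↥(maximalRealSubfield L)) L (IsCMField.complexConj L) 3).Adelic).subtype (commute_of_mem_bot ((standardMaximalCompactGL 3 L).comap (adelicVal (↥(maximalRealSubfield L)) L (IsCMField.complexConj L) 3 ((StdForm.antidiagonal 3).over L)) :
      Subgroup (quasiSplit (↥(maximalRealSubfield L)) L (IsCMField.complexConj L) 3).Adelic).subtype) ((((quasiSplit (↥(maximalRealSubfield L)) L (IsCMField.complexConj L) 3).rightRegular μ).restrict ((standardMaximalCompactGL 3 L).comap (adelicVal (↥(maximalRealSubfield L)) L (IsCMField.complexConj L) 3 ((StdForm.antidiagonal 3).over L)) :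
      Subgroup (quasiSplit (↥(maximalRealSubfield L)) L (IsCMField.complexConj L) 3).Adelic).subtype).subRep E hE)) ((LinearMap.fst ℂ ((quasiSplit (↥(maximalRealSubfield L)) L (IsCMField.complexConj L) 3).Adelic → ℂ) ((quasiSplit (↥(maximalRealSubfield L)) L (IsCMField.complexConj L) 3).L2 μ)) ∘ₗ (Gr ⊓ (chiSectionSpacePairKType (ξ.bcη⁻¹ * ξ.bcψ⁻¹ * μω) ξ.ψ (⊥ : Subgroup (quasiSplit (↥(maximalRealSubfield L)) L (IsCMField.complexConj L) 3).Adelic) ((1 : ↥(⊥ : Subgroup (quasiSplit (↥(maximalRealSubfield L)) L (IsCMField.complexConj L) 3).Adelic) →* ℂ) : ↥(⊥ : Subgroup (quasiSplit (↥(maximalRealSubfield L)) L (IsCMField.complexConj L) 3).Adelic) → ℂ) ((standardMaximalCompactGL 3 L).comap (adelicVal (↥(maximalRealSubfield L)) L (IsCMField.complexConj L) 3 ((StdForm.antidiagonal 3).over L)) :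
      Subgroup (quasiSplit (↥(maximalRealSubfield L)) L (IsCMField.complexConj L) 3).Adelic).subtype (commute_of_mem_bot ((standardMaximalCompactGL 3 L).comap (adelicVal (↥(maximalRealSubfield L)) L (IsCMField.complexConj L) 3 ((StdForm.antidiagonal 3).over L)) :
      Subgroup (quasiSplit (↥(maximalRealSubfield L)) L (IsCMField.complexConj L) 3).Adelic).subtype) ((((quasiSplit (↥(maximalRealSubfield L)) L (IsCMField.complexConj L) 3).rightRegular μ).restrict ((standardMaximalCompactGL 3 L).comap (adelicVal (↥(maximalRealSubfield L)) L (IsCMField.complexConj L) 3 ((StdForm.antidiagonal 3).over L)) :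
      Subgroup (quasiSplit (↥(maximalRealSubfield L)) L (IsCMField.complexConj L) 3).Adelic).subtype).subRep E hE)).comap (LinearMap.fst ℂ ((quasiSplit (↥(maximalRealSubfield L)) L (IsCMField.complexConj L) 3).Adelic → ℂ) ((quasiSplit (↥(maximalRealSubfield L)) L (IsCMField.complexConj L) 3).L2 μ))).subtype) fun p => p.2.2) fun p q h => ?_
    have h1 : (p : ((quasiSplit (↥(maximalRealSubfield L)) L (IsCMField.complexConj L) 3).Adelic → ℂ) × (quasiSplit (↥(maximalRealSubfield L)) L (IsCMField.complexConj L) 3).L2 μ).1 = (q : ((quasiSplit (↥(maximalRealSubfield L)) L (IsCMField.complexConj L) 3).Adelic → ℂ) × (quasiSplit (↥(maximalRealSubfield L)) L (IsCMField.complexConj L) 3).L2 μ).1 := congrArg Subtype.val h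
    exact Subtype.ext (Prod.ext h1 (midResidueGraph_snd_eq_of_fst_eq L μ ξ μω Gr hGr _ p.2.1 _ q.2.1 h1))
  haveI hFfd : FiniteDimensional ℂ ↥((Gr ⊓ (chiSectionSpacePairKType (ξ.bcη⁻¹ * ξ.bcψ⁻¹ * μω) ξ.ψ (⊥ : Subgroup (quasiSplit (↥(maximalRealSubfield L)) L (IsCMField.complexConj L) 3).Adelic) ((1 : ↥(⊥ : Subgroup (quasiSplit (↥(maximalRealSubfield L)) L (IsCMField.complexConj L) 3).Adelic) →* ℂ) : ↥(⊥ : Subgroup (quasiSplit (↥(maximalRealSubfield L)) L (IsCMField.complexConj L) 3).Adelic) → ℂ) ((standardMaximalCompactGL 3 L).comap (adelicVal (↥(maximalRealSubfield L)) L (IsCMField.complexConj L) 3 ((StdForm.antidiagonal 3).over L)) :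
      Subgroup (quasiSplit (↥(maximalRealSubfield L)) L (IsCMField.complexConj L) 3).Adelic).subtype (commute_of_mem_bot ((standardMaximalCompactGL 3 L).comap (adelicVal (↥(maximalRealSubfield L)) L (IsCMField.complexConj L) 3 ((StdForm.antidiagonal 3).over L)) :
      Subgroup (quasiSplit (↥(maximalRealSubfield L)) L (IsCMField.complexConj L) 3).Adelic).subtype) ((((quasiSplit (↥(maximalRealSubfield L)) L (IsCMField.complexConj L) 3).rightRegular μ).restrict ((standardMaximalCompactGL 3 L).comap (adelicVal (↥(maximalRealSubfield L)) L (IsCMField.complexConj L) 3 ((StdForm.antidiagonal 3).over L)) :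
      Subgroup (quasiSplit (↥(maximalRealSubfield L)) L (IsCMField.complexConj L) 3).Adelic).subtype).subRep E hE)).comap (LinearMap.fst ℂ ((quasiSplit (↥(maximalRealSubfield L)) L (IsCMField.complexConj L) 3).Adelic → ℂ) ((quasiSplit (↥(maximalRealSubfield L)) L (IsCMField.complexConj L) 3).L2 μ))).map (LinearMap.snd ℂ ((quasiSplit (↥(maximalRealSubfield L)) L (IsCMField.complexConj L) 3).Adelic → ℂ) ((quasiSplit (↥(maximalRealSubfield L)) L (IsCMField.complexConj L) 3).L2 μ))) := Module.Finite.map _ _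
  refine finiteDimensional_homRangeSum_subRep_of_generators (((quasiSplit (↥(maximalRealSubfield L)) L (IsCMField.complexConj L) 3).rightRegular μ).restrict ((standardMaximalCompactGL 3 L).comap (adelicVal (↥(maximalRealSubfield L)) L (IsCMField.complexConj L) 3 ((StdForm.antidiagonal 3).over L)) :
      Subgroup (quasiSplit (↥(maximalRealSubfield L)) L (IsCMField.complexConj L) 3).Adelic).subtype) ((((quasiSplit (↥(maximalRealSubfield L)) L (IsCMField.complexConj L) 3).rightRegular μ).restrict ((standardMaximalCompactGL 3 L).comap (adelicVal (↥(maximalRealSubfield L)) L (IsCMField.complexConj L) 3 ((StdForm.antidiagonal 3).over L)) :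
      Subgroup (quasiSplit (↥(maximalRealSubfield L)) L (IsCMField.complexConj L) 3).Adelic).subtype).subRep E hE) hA hW1 (F := (Gr ⊓ (chiSectionSpacePairKType (ξ.bcη⁻¹ * ξ.bcψ⁻¹ * μω) ξ.ψ (⊥ : Subgroup (quasiSplit (↥(maximalRealSubfield L)) L (IsCMField.complexConj L) 3).Adelic) ((1 : ↥(⊥ : Subgroup (quasiSplit (↥(maximalRealSubfield L)) L (IsCMField.complexConj L) 3).Adelic) →* ℂ) : ↥(⊥ : Subgroup (quasiSplit (↥(maximalRealSubfield L)) L (IsCMField.complexConj L) 3).Adelic) → ℂ) ((standardMaximalCompactGL 3 L).comap (adelicVal (↥(maximalRealSubfield L)) L (IsCMField.complexConj L) 3 ((StdForm.antidiagonal 3).over L)) :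
      Subgroup (quasiSplit (↥(maximalRealSubfield L)) L (IsCMField.complexConj L) 3).Adelic).subtype (commute_of_mem_bot ((standardMaximalCompactGL 3 L).comap (adelicVal (↥(maximalRealSubfield L)) L (IsCMField.complexConj L) 3 ((StdForm.antidiagonal 3).over L)) :
      Subgroup (quasiSplit (↥(maximalRealSubfield L)) L (IsCMField.complexConj L) 3).Adelic).subtype) ((((quasiSplit (↥(maximalRealSubfield L)) L (IsCMField.complexConj L) 3).rightRegular μ).restrict ((standardMaximalCompactGL 3 L).comap (adelicVal (↥(maximalRealSubfield L)) L (IsCMField.complexConj L) 3 ((StdForm.antidiagonal 3).over L)) :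
      Subgroup (quasiSplit (↥(maximalRealSubfield L)) L (IsCMField.complexConj L) 3).Adelic).subtype).subRep E hE)).comap (LinearMap.fst ℂ ((quasiSplit (↥(maximalRealSubfield L)) L (IsCMField.complexConj L) 3).Adelic → ℂ) ((quasiSplit (↥(maximalRealSubfield L)) L (IsCMField.complexConj L) 3).L2 μ))).map (LinearMap.snd ℂ ((quasiSplit (↥(maximalRealSubfield L)) L (IsCMField.complexConj L) 3).Adelic → ℂ) ((quasiSplit (↥(maximalRealSubfield L)) L (IsCMField.complexConj L) 3).L2 μ))) ?_
  rintro g ⟨φ, hrel, S, hS, hφS, hSfd, hSirr⟩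
  haveI : FiniteDimensional ℂ ↥S := hSfd
  have hp : (φ, g) ∈ Gr := (hGr _).2 hrel
  by_cases hφ0 : φ = 0
  · have hg0 : g = 0 := midResidueGraph_snd_eq_zero_of_fst_eq_zero L μ ξ μω Gr hGr (φ, g) hp hφ0
    rw [hg0, map_zero]
    exact Submodule.zero_mem _
  -- `S ⊆ dom Res`: the domain is `K_max`-stable and meets the irreducible `S` in `φ ≠ 0`
  have hSD : S ≤ Gr.map (LinearMap.fst ℂ ((quasiSplit (↥(maximalRealSubfield L)) L (IsCMField.complexConj L) 3).Adelic → ℂ) ((quasiSplit (↥(maximalRealSubfield L)) L (IsCMField.complexConj L) 3).L2 μ)) :=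
    submodule_le_of_isIrreducible ((rightTranslation (quasiSplit (↥(maximalRealSubfield L)) L (IsCMField.complexConj L) 3)).comp ((standardMaximalCompactGL 3 L).comap (adelicVal (↥(maximalRealSubfield L)) L (IsCMField.complexConj L) 3 ((StdForm.antidiagonal 3).over L)) :
      Subgroup (quasiSplit (↥(maximalRealSubfield L)) L (IsCMField.complexConj L) 3).Adelic).subtype) hS hSirr (fun k ψ hψ => rightTranslation_mem_map_fst_midResidueGraph L μ ξ μω Gr hGr k.2 hψ) hφS ⟨(φ, g), hp, rfl⟩ hφ0
  -- `Res|_S` as a `K_max`-map into `σ`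
  let ResS : (Subrepresentation.toRepresentation (⟨S, hS⟩ : Subrepresentation ((rightTranslation (quasiSplit (↥(maximalRealSubfield L)) L (IsCMField.complexConj L) 3)).comp ((standardMaximalCompactGL 3 L).comap (adelicVal (↥(maximalRealSubfield L)) L (IsCMField.complexConj L) 3 ((StdForm.antidiagonal 3).over L)) :
      Subgroup (quasiSplit (↥(maximalRealSubfield L)) L (IsCMField.complexConj L) 3).Adelic).subtype))).IntertwiningMap (((quasiSplit (↥(maximalRealSubfield L)) L (IsCMField.complexConj L) 3).rightRegular μ).restrict ((standardMaximalCompactGL 3 L).comap (adelicVal (↥(maximalRealSubfield L)) L (IsCMField.complexConj L) 3 ((StdForm.antidiagonal 3).over L)) :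
      Subgroup (quasiSplit (↥(maximalRealSubfield L)) L (IsCMField.complexConj L) 3).Adelic).subtype).toRepresentation :=
    { toLinearMap := Gr.toLinearPMap.toFun ∘ₗ Submodule.inclusion hSD
      isIntertwining' := fun k => LinearMap.ext fun ψ => toLinearPMap_rightTranslation L μ ξ μω Gr hGr k.2 ⟨(ψ : (quasiSplit (↥(maximalRealSubfield L)) L (IsCMField.complexConj L) 3).Adelic → ℂ), hSD ψ.2⟩ }
  have hResφ : ResS ⟨φ, hφS⟩ = g :=
    midResidueGraph_snd_eq_of_fst_eq L μ ξ μω Gr hGr _ (mem_midResidueGraph_toLinearPMap L μ ξ μω Gr hGr ⟨φ, hSD hφS⟩) _ hp rfl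
  haveI := hSirr
  rcases Representation.IsIrreducible.injective_or_eq_zero ResS with hinj | h0
  · -- `N := Res(S) ≅ S`, irreducible, finite-dimensional, stable, contains `g`
    have hNirr := isIrreducible_subRep_range_of_injective (((quasiSplit (↥(maximalRealSubfield L)) L (IsCMField.complexConj L) 3).rightRegular μ).restrict ((standardMaximalCompactGL 3 L).comap (adelicVal (↥(maximalRealSubfield L)) L (IsCMField.complexConj L) 3 ((StdForm.antidiagonal 3).over L)) :
      Subgroup (quasiSplit (↥(maximalRealSubfield L)) L (IsCMField.complexConj L) 3).Adelic).subtype) hSirr ResS hinj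
    have hgN : g ∈ LinearMap.range ResS.toLinearMap := ⟨⟨φ, hφS⟩, hResφ⟩
    refine starProjection_closure_homRangeSum_mem_of_dichotomy (((quasiSplit (↥(maximalRealSubfield L)) L (IsCMField.complexConj L) 3).rightRegular μ).restrict ((standardMaximalCompactGL 3 L).comap (adelicVal (↥(maximalRealSubfield L)) L (IsCMField.complexConj L) 3 ((StdForm.antidiagonal 3).over L)) :
      Subgroup (quasiSplit (↥(maximalRealSubfield L)) L (IsCMField.complexConj L) 3).Adelic).subtype) ((((quasiSplit (↥(maximalRealSubfield L)) L (IsCMField.complexConj L) 3).rightRegular μ).restrict ((standardMaximalCompactGL 3 L).comap (adelicVal (↥(maximalRealSubfield L)) L (IsCMField.complexConj L) 3 ((StdForm.antidiagonal 3).over L)) :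
      Subgroup (quasiSplit (↥(maximalRealSubfield L)) L (IsCMField.complexConj L) 3).Adelic).subtype).subRep E hE) hσu (apply_mem_range_of_mem_range (((quasiSplit (↥(maximalRealSubfield L)) L (IsCMField.complexConj L) 3).rightRegular μ).restrict ((standardMaximalCompactGL 3 L).comap (adelicVal (↥(maximalRealSubfield L)) L (IsCMField.complexConj L) 3 ((StdForm.antidiagonal 3).over L)) :
      Subgroup (quasiSplit (↥(maximalRealSubfield L)) L (IsCMField.complexConj L) 3).Adelic).subtype) ResS) hNirr hirr ?_ hgN
    rintro ⟨e⟩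
    obtain ⟨e₂⟩ := nonempty_equiv_subRep_range_of_injective (((quasiSplit (↥(maximalRealSubfield L)) L (IsCMField.complexConj L) 3).rightRegular μ).restrict ((standardMaximalCompactGL 3 L).comap (adelicVal (↥(maximalRealSubfield L)) L (IsCMField.complexConj L) 3 ((StdForm.antidiagonal 3).over L)) :
      Subgroup (quasiSplit (↥(maximalRealSubfield L)) L (IsCMField.complexConj L) 3).Adelic).subtype) ResS hinj
    -- `e₃ : τ ≃ S`, so `S ⊆ V(⊥,1)^τ` (★ (3′) L3 on the section-valued `K_max`-map `τ → S ↪ sections`)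
    let e₃ := e.trans e₂.symm
    have hTV : ∀ w : ↥E, (S.subtype ∘ₗ e₃.toLinearMap) w ∈ chiSectionSpacePair (ξ.bcη⁻¹ * ξ.bcψ⁻¹ * μω) ξ.ψ (⊥ : Subgroup (quasiSplit (↥(maximalRealSubfield L)) L (IsCMField.complexConj L) 3).Adelic)
          ((1 : ↥(⊥ : Subgroup (quasiSplit (↥(maximalRealSubfield L)) L (IsCMField.complexConj L) 3).Adelic) →* ℂ) : ↥(⊥ : Subgroup (quasiSplit (↥(maximalRealSubfield L)) L (IsCMField.complexConj L) 3).Adelic) → ℂ) := fun w => by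
      obtain ⟨p, hpGr, hp1⟩ := hSD (e₃ w).2
      rw [← show p.1 = (S.subtype ∘ₗ e₃.toLinearMap) w from hp1]
      exact ((hGr p).1 hpGr).1
    have hT : ∀ (k : ↥((standardMaximalCompactGL 3 L).comap (adelicVal (↥(maximalRealSubfield L)) L (IsCMField.complexConj L) 3 ((StdForm.antidiagonal 3).over L)) :
      Subgroup (quasiSplit (↥(maximalRealSubfield L)) L (IsCMField.complexConj L) 3).Adelic)) (w : ↥E),
        (S.subtype ∘ₗ e₃.toLinearMap) (((((quasiSplit (↥(maximalRealSubfield L)) L (IsCMField.complexConj L) 3).rightRegular μ).restrict ((standardMaximalCompactGL 3 L).comap (adelicVal (↥(maximalRealSubfield L)) L (IsCMField.complexConj L) 3 ((StdForm.antidiagonal 3).over L)) :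
      Subgroup (quasiSplit (↥(maximalRealSubfield L)) L (IsCMField.complexConj L) 3).Adelic).subtype).subRep E hE) k w) = rightTranslation (quasiSplit (↥(maximalRealSubfield L)) L (IsCMField.complexConj L) 3) (((standardMaximalCompactGL 3 L).comap (adelicVal (↥(maximalRealSubfield L)) L (IsCMField.complexConj L) 3 ((StdForm.antidiagonal 3).over L)) :
      Subgroup (quasiSplit (↥(maximalRealSubfield L)) L (IsCMField.complexConj L) 3).Adelic).subtype k) ((S.subtype ∘ₗ e₃.toLinearMap) w) := fun k w => by
      simp only [LinearMap.coe_comp, Function.comp_apply, Submodule.subtype_apply, Representation.IntertwiningMap.coe_toLinearMap]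
      rw [Representation.IntertwiningMap.isIntertwining _ _ e₃.toIntertwiningMap k w]
      rfl
    have hSV : S ≤ (chiSectionSpacePairKType (ξ.bcη⁻¹ * ξ.bcψ⁻¹ * μω) ξ.ψ (⊥ : Subgroup (quasiSplit (↥(maximalRealSubfield L)) L (IsCMField.complexConj L) 3).Adelic) ((1 : ↥(⊥ : Subgroup (quasiSplit (↥(maximalRealSubfield L)) L (IsCMField.complexConj L) 3).Adelic) →* ℂ) : ↥(⊥ : Subgroup (quasiSplit (↥(maximalRealSubfield L)) L (IsCMField.complexConj L) 3).Adelic) → ℂ) ((standardMaximalCompactGL 3 L).comap (adelicVal (↥(maximalRealSubfield L)) L (IsCMField.complexConj L) 3 ((StdForm.antidiagonal 3).over L)) :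
      Subgroup (quasiSplit (↥(maximalRealSubfield L)) L (IsCMField.complexConj L) 3).Adelic).subtype (commute_of_mem_bot ((standardMaximalCompactGL 3 L).comap (adelicVal (↥(maximalRealSubfield L)) L (IsCMField.complexConj L) 3 ((StdForm.antidiagonal 3).over L)) :
      Subgroup (quasiSplit (↥(maximalRealSubfield L)) L (IsCMField.complexConj L) 3).Adelic).subtype) ((((quasiSplit (↥(maximalRealSubfield L)) L (IsCMField.complexConj L) 3).rightRegular μ).restrict ((standardMaximalCompactGL 3 L).comap (adelicVal (↥(maximalRealSubfield L)) L (IsCMField.complexConj L) 3 ((StdForm.antidiagonal 3).over L)) :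
      Subgroup (quasiSplit (↥(maximalRealSubfield L)) L (IsCMField.complexConj L) 3).Adelic).subtype).subRep E hE)) := fun ψ hψ => by
      have h : LinearMap.range (S.subtype ∘ₗ e₃.toLinearMap) ≤ (chiSectionSpacePairKType (ξ.bcη⁻¹ * ξ.bcψ⁻¹ * μω) ξ.ψ (⊥ : Subgroup (quasiSplit (↥(maximalRealSubfield L)) L (IsCMField.complexConj L) 3).Adelic) ((1 : ↥(⊥ : Subgroup (quasiSplit (↥(maximalRealSubfield L)) L (IsCMField.complexConj L) 3).Adelic) →* ℂ) : ↥(⊥ : Subgroup (quasiSplit (↥(maximalRealSubfield L)) L (IsCMField.complexConj L) 3).Adelic) → ℂ) ((standardMaximalCompactGL 3 L).comap (adelicVal (↥(maximalRealSubfield L)) L (IsCMField.complexConj L) 3 ((StdForm.antidiagonal 3).over L)) :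
      Subgroup (quasiSplit (↥(maximalRealSubfield L)) L (IsCMField.complexConj L) 3).Adelic).subtype (commute_of_mem_bot ((standardMaximalCompactGL 3 L).comap (adelicVal (↥(maximalRealSubfield L)) L (IsCMField.complexConj L) 3 ((StdForm.antidiagonal 3).over L)) :
      Subgroup (quasiSplit (↥(maximalRealSubfield L)) L (IsCMField.complexConj L) 3).Adelic).subtype) ((((quasiSplit (↥(maximalRealSubfield L)) L (IsCMField.complexConj L) 3).rightRegular μ).restrict ((standardMaximalCompactGL 3 L).comap (adelicVal (↥(maximalRealSubfield L)) L (IsCMField.complexConj L) 3 ((StdForm.antidiagonal 3).over L)) :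
      Subgroup (quasiSplit (↥(maximalRealSubfield L)) L (IsCMField.complexConj L) 3).Adelic).subtype).subRep E hE)) :=
        range_le_chiSectionSpacePairKType (S.subtype ∘ₗ e₃.toLinearMap) hTV hT
      have hψ' : ψ = (S.subtype ∘ₗ e₃.toLinearMap) (e₃.symm ⟨ψ, hψ⟩) := by
        simp only [LinearMap.coe_comp, Function.comp_apply, Submodule.subtype_apply, Representation.IntertwiningMap.coe_toLinearMap, Representation.Equiv.coe_toIntertwiningMap,
          Representation.Equiv.apply_symm_apply]
      rw [hψ']
      exact h ⟨_, rfl⟩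
    -- `N ≤ M_τ`
    rintro _ ⟨ψ, rfl⟩
    exact ⟨((ψ : (quasiSplit (↥(maximalRealSubfield L)) L (IsCMField.complexConj L) 3).Adelic → ℂ), ResS ψ), ⟨mem_midResidueGraph_toLinearPMap L μ ξ μω Gr hGr ⟨(ψ : (quasiSplit (↥(maximalRealSubfield L)) L (IsCMField.complexConj L) 3).Adelic → ℂ), hSD ψ.2⟩, hSV ψ.2⟩, rfl⟩
  · -- `Res|_S = 0`: `g = Res φ = 0`
    have hg0 : g = 0 := by
      rw [← hResφ, h0, Representation.IntertwiningMap.coe_zero, Pi.zero_apply]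
    rw [hg0, map_zero]
    exact Submodule.zero_mem _

/-- **THE `hADM` LETTER OF ★ p863816 FROM {`hSUM`, (W1′)}** — conclusion = the `hADM` binder bytes of ★ `hDISC_of_inv_of_admissible` (`R90S8ResGMidBlockDiscreteOfKTypesU3` :356–:369) VERBATIM,
∀-closed over `(L, μ, μω, hμu, ξ)`; hypotheses ∀-closed in the same frame: `hSUM` = ★ p863302's Godement summability of the level-free block sections on `2 < Re z` (★
`summable_eisensteinSeriesU_flatSectionU_cm_three` for bounded sections; the boundedness of the block's continuous sections is the only gap), `hW1` = (W1′) «the level-free atom lies in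
the closed span of the residue classes of sections belonging to a finite-dimensional `K_max`-stable IRREDUCIBLE space of sections» [MW95 I.2.17 + V.3.13: `K`-finite residues are total;
unitarian trick; as typed, exactly as true as `hDISC` — the wild generators of ★ D1].  Consumer: `hDISC_of_inv_of_admissible hINV (hADM_of_letters hSUM hW1)`, so (R)′'s row `hDISC` =
★ ∘ {(INV), (W1′), hSUM}. [cite: WallachRRG1, §3.3.1] [cite: MoeglinWaldspurger1995, I.2.17, V.3.13] [cite: Rogawski1990, §13.9 p. 229 (ii)] -/
theorem hADM_of_letters
    (hSUM : ∀ (L : Type) [Field L] [NumberField L] [IsCMField L]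
      (μ : Measure (quasiSplit (↥(maximalRealSubfield L)) L (IsCMField.complexConj L) 3).automorphicQuotient) [(quasiSplit (↥(maximalRealSubfield L)) L (IsCMField.complexConj L) 3).IsAutomorphicMeasure μ]
      (μω : HeckeCharacter L) (_ : μω.IsUnitary) (ξ : OneDimAutRepH L), ∀ φ ∈ chiSectionSpacePair (ξ.bcη⁻¹ * ξ.bcψ⁻¹ * μω) ξ.ψ (⊥ : Subgroup (quasiSplit (↥(maximalRealSubfield L)) L (IsCMField.complexConj L) 3).Adelic)
          ((1 : ↥(⊥ : Subgroup (quasiSplit (↥(maximalRealSubfield L)) L (IsCMField.complexConj L) 3).Adelic) →* ℂ) : ↥(⊥ : Subgroup (quasiSplit (↥(maximalRealSubfield L)) L (IsCMField.complexConj L) 3).Adelic) → ℂ),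
      Continuous φ → ∀ z : ℂ, 2 < z.re → ∀ g : (quasiSplit (↥(maximalRealSubfield L)) L (IsCMField.complexConj L) 3).Adelic,
      Summable fun q : Quotient (MulAction.orbitRel ↥(borelU ((IsCMField.complexConj L : L ≃ₐ[↥(maximalRealSubfield L)] L) : L →+* L) ((StdForm.antidiagonal 3).over L)) ↥(unitaryGroupOfForm ((IsCMField.complexConj L : L ≃ₐ[↥(maximalRealSubfield L)] L) : L →+* L) ((StdForm.antidiagonal 3).over L))) =>
        ‖flatSectionU φ z ((quasiSplit (↥(maximalRealSubfield L)) L (IsCMField.complexConj L) 3).toAdelic (Quotient.out q : ↥(unitaryGroupOfForm ((IsCMField.complexConj L : L ≃ₐ[↥(maximalRealSubfield L)] L) : L →+* L) ((StdForm.antidiagonal 3).over L))) * g)‖)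
    (hW1 : ∀ (L : Type) [Field L] [NumberField L] [IsCMField L]
      (μ : Measure (quasiSplit (↥(maximalRealSubfield L)) L (IsCMField.complexConj L) 3).automorphicQuotient) [(quasiSplit (↥(maximalRealSubfield L)) L (IsCMField.complexConj L) 3).IsAutomorphicMeasure μ]
      (μω : HeckeCharacter L) (_ : μω.IsUnitary) (ξ : OneDimAutRepH L), resGMidAtom L μ ξ μω ⊥ 1 ≤ (Submodule.span ℂ {f : (quasiSplit (↥(maximalRealSubfield L)) L (IsCMField.complexConj L) 3).L2 μ | ∃ φ : (quasiSplit (↥(maximalRealSubfield L)) L (IsCMField.complexConj L) 3).Adelic → ℂ, (φ ∈ chiSectionSpacePair (ξ.bcη⁻¹ * ξ.bcψ⁻¹ * μω) ξ.ψ (⊥ : Subgroup (quasiSplit (↥(maximalRealSubfield L)) L (IsCMField.complexConj L) 3).Adelic)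
          ((1 : ↥(⊥ : Subgroup (quasiSplit (↥(maximalRealSubfield L)) L (IsCMField.complexConj L) 3).Adelic) →* ℂ) : ↥(⊥ : Subgroup (quasiSplit (↥(maximalRealSubfield L)) L (IsCMField.complexConj L) 3).Adelic) → ℂ) ∧ Continuous φ ∧
          ∃ (Ec : ℂ → (quasiSplit (↥(maximalRealSubfield L)) L (IsCMField.complexConj L) 3).Adelic → ℂ) (Sp : Finset ℂ)
            (_ : ∀ s ∈ Sp, s.im = 0 ∧ 1 < s.re ∧ s.re ≤ 2)
            (_ : ∀ g, DifferentiableOn ℂ (fun z => Ec z g) ({z : ℂ | 1 < z.re} \ (↑Sp : Set ℂ)))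
            (_ : ∀ z : ℂ, 2 < z.re → Ec z = eisensteinSeriesU (flatSectionU φ z))
            (Fp : (quasiSplit (↥(maximalRealSubfield L)) L (IsCMField.complexConj L) 3).Adelic → ℂ → ℂ)
            (_ : ∀ g, AnalyticAt ℂ (Fp g) ((3 : ℂ) / 2))
            (_ : ∀ g, Fp g =ᶠ[𝓝[≠] ((3 : ℂ) / 2)] fun z => (z - (3 : ℂ) / 2) * Ec z g),
            (f : (quasiSplit (↥(maximalRealSubfield L)) L (IsCMField.complexConj L) 3).automorphicQuotient → ℂ) =ᵐ[μ] (fun x : (quasiSplit (↥(maximalRealSubfield L)) L (IsCMField.complexConj L) 3).automorphicQuotient => Fp (Quotient.out (x : ((quasiSplit (↥(maximalRealSubfield L)) L (IsCMField.complexConj L) 3).Adelic ⧸ (quasiSplit (↥(maximalRealSubfield L)) L (IsCMField.complexConj L) 3).quotientSubgroup)))⁻¹ ((3 : ℂ) / 2))) ∧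
          ∃ (S : Submodule ℂ ((quasiSplit (↥(maximalRealSubfield L)) L (IsCMField.complexConj L) 3).Adelic → ℂ)) (hS : ∀ k : ↥((standardMaximalCompactGL 3 L).comap (adelicVal (↥(maximalRealSubfield L)) L (IsCMField.complexConj L) 3 ((StdForm.antidiagonal 3).over L)) :
      Subgroup (quasiSplit (↥(maximalRealSubfield L)) L (IsCMField.complexConj L) 3).Adelic), ∀ ψ ∈ S, ((rightTranslation (quasiSplit (↥(maximalRealSubfield L)) L (IsCMField.complexConj L) 3)).comp ((standardMaximalCompactGL 3 L).comap (adelicVal (↥(maximalRealSubfield L)) L (IsCMField.complexConj L) 3 ((StdForm.antidiagonal 3).over L)) :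
      Subgroup (quasiSplit (↥(maximalRealSubfield L)) L (IsCMField.complexConj L) 3).Adelic).subtype) k ψ ∈ S),
            φ ∈ S ∧ FiniteDimensional ℂ ↥S ∧ (Subrepresentation.toRepresentation (⟨S, hS⟩ : Subrepresentation ((rightTranslation (quasiSplit (↥(maximalRealSubfield L)) L (IsCMField.complexConj L) 3)).comp ((standardMaximalCompactGL 3 L).comap (adelicVal (↥(maximalRealSubfield L)) L (IsCMField.complexConj L) 3 ((StdForm.antidiagonal 3).over L)) :
      Subgroup (quasiSplit (↥(maximalRealSubfield L)) L (IsCMField.complexConj L) 3).Adelic).subtype))).IsIrreducible}).topologicalClosure) :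
    ∀ (L : Type) [Field L] [NumberField L] [IsCMField L]
      (μ : Measure (quasiSplit (↥(maximalRealSubfield L)) L (IsCMField.complexConj L) 3).automorphicQuotient) [(quasiSplit (↥(maximalRealSubfield L)) L (IsCMField.complexConj L) 3).IsAutomorphicMeasure μ]
      (μω : HeckeCharacter L) (_ : μω.IsUnitary) (ξ : OneDimAutRepH L)
      (hA : ∀ (k : ↥((standardMaximalCompactGL 3 L).comap (adelicVal (↥(maximalRealSubfield L)) L (IsCMField.complexConj L) 3 ((StdForm.antidiagonal 3).over L)) :
        Subgroup (quasiSplit (↥(maximalRealSubfield L)) L (IsCMField.complexConj L) 3).Adelic)), ∀ x ∈ resGMidAtom L μ ξ μω ⊥ 1,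
          (((quasiSplit (↥(maximalRealSubfield L)) L (IsCMField.complexConj L) 3).rightRegular μ).restrict
            (((standardMaximalCompactGL 3 L).comap (adelicVal (↥(maximalRealSubfield L)) L (IsCMField.complexConj L) 3 ((StdForm.antidiagonal 3).over L)) :
              Subgroup (quasiSplit (↥(maximalRealSubfield L)) L (IsCMField.complexConj L) 3).Adelic)).subtype) k x ∈ resGMidAtom L μ ξ μω ⊥ 1)
      (E : Submodule ℂ ((quasiSplit (↥(maximalRealSubfield L)) L (IsCMField.complexConj L) 3).L2 μ)) (_ : E ≤ resGMidAtom L μ ξ μω ⊥ 1)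
      (hE : ∀ k, ∀ x ∈ E, (((quasiSplit (↥(maximalRealSubfield L)) L (IsCMField.complexConj L) 3).rightRegular μ).restrict
            (((standardMaximalCompactGL 3 L).comap (adelicVal (↥(maximalRealSubfield L)) L (IsCMField.complexConj L) 3 ((StdForm.antidiagonal 3).over L)) :
              Subgroup (quasiSplit (↥(maximalRealSubfield L)) L (IsCMField.complexConj L) 3).Adelic)).subtype) k x ∈ E), FiniteDimensional ℂ E →
      ((((quasiSplit (↥(maximalRealSubfield L)) L (IsCMField.complexConj L) 3).rightRegular μ).restrict
            (((standardMaximalCompactGL 3 L).comap (adelicVal (↥(maximalRealSubfield L)) L (IsCMField.complexConj L) 3 ((StdForm.antidiagonal 3).over L)) :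
              Subgroup (quasiSplit (↥(maximalRealSubfield L)) L (IsCMField.complexConj L) 3).Adelic)).subtype).subRep E hE).IsIrreducible →
      FiniteDimensional ℂ ↥(Representation.homRangeSum
        ((((quasiSplit (↥(maximalRealSubfield L)) L (IsCMField.complexConj L) 3).rightRegular μ).restrict
            (((standardMaximalCompactGL 3 L).comap (adelicVal (↥(maximalRealSubfield L)) L (IsCMField.complexConj L) 3 ((StdForm.antidiagonal 3).over L)) :
              Subgroup (quasiSplit (↥(maximalRealSubfield L)) L (IsCMField.complexConj L) 3).Adelic)).subtype).subRep (resGMidAtom L μ ξ μω ⊥ 1) hA)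
        ((((quasiSplit (↥(maximalRealSubfield L)) L (IsCMField.complexConj L) 3).rightRegular μ).restrict
            (((standardMaximalCompactGL 3 L).comap (adelicVal (↥(maximalRealSubfield L)) L (IsCMField.complexConj L) 3 ((StdForm.antidiagonal 3).over L)) :
              Subgroup (quasiSplit (↥(maximalRealSubfield L)) L (IsCMField.complexConj L) 3).Adelic)).subtype).subRep E hE)) :=
  fun L _ _ _ μ _ μω hμu ξ hA E _ hE hfd hirr =>
    finiteDimensional_homRangeSum_resGMidAtom_bot_of_letters L μ ξ μω (hSUM L μ μω hμu ξ) (hW1 L μ μω hμu ξ) hA E hE hfd hirr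

end Main

end Summit.HodgeConjecture.HodgeConjecture.R90.S8

end
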